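import Literature.AnabelianGeometry.EtaleTheta.FrobenioidMonoTheta
import Literature.AnabelianGeometry.EtaleTheta.Discharge.Sec5Cor512UniversalClosureRefuted

/-!
# [EtTh] Lemma 5.8: the universal closures of `ConstantsEqNormalizer` and `KxRootNModCyclotome` over the
# abstract §5 interface are FALSE (kernel countermodels; FACT-LIST rows F-0536, F-0538 — R5 «named instances only»)

Mochizuki, *The étale theta function and its Frobenioid-theoretic manifestations*, Publ. RIMS **45**
(2009), Lemma 5.8 (Conjugation by Constants), p.331 (PDF p.105) [cite: MochizukiEtTh2009, Lem 5.8 p.331 (PDF p.105)].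
Cell abc-iut, block F (fact-proving wave), seat abc-iut-f-096 (floating onto the unminted tranche 121);
PROOF-ONLY companion of abc-iut-L2-t4's `FrobenioidMonoTheta.lean` (statements
`ThetaFrobenioid.ConstantsEqNormalizer` — "`(O_K^×)^{1/N}` is equal to the set of elements of `O^×(B_N)` that
normalize the subgroup `E_N ⊆ Aut_C(B_N)`" — and `ThetaFrobenioid.KxRootNModCyclotome` — the `N`-th power map
`(K^×)^{1/N} → K^×` is onto with kernel the image of `μ_N(B_N)`).  No new `Prop` fact, no edit of the
statement file; the only definitions are the two toy data below, both one-field variants of abc-iut-f-112's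
landed toy §5 datum `ConstantMultiple.Cor512Toy.toyTheta` (`Sec5Cor512UniversalClosureRefuted.lean`:
`C :=` walking arrow `×` one-object category on `ℤ/2`, constant base to `Discrete PUnit`, `A_N = B_N = Q`,
`O^×(Q) ≅ O^×(Q^birat) := ℤ/2`, `K := 𝔽₂`, all sections trivial, `N := 2`).

WHAT IS PROVED.
* `toyThetaN3 := { toyTheta with N := 3 }`: since `K^× = 1` and cubing is the identity on `ℤ/2`,
  `(K^×)^{1/3} = 1`, so `(O_K^×)^{1/N} = 1`; but `Aut_C(Q)` is abelian, so every element of `O^×(B_N) ≅ ℤ/2`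
  normalizes `E_N`: `ConstantsEqNormalizer` FAILS (`not_constantsEqNormalizer_toyN3`), hence
  `not_forall_constantsEqNormalizer`.
* `toyThetaBig := { toyTheta with O^×(−^birat) := ℤ/2 × ℤ/2 }` (units embedded in the first factor, constants
  trivial): `f = (1, m₀)` lies in `(K^×)^{1/2}` and satisfies `f² = 1`, but is not in the image of
  `μ_2(B_N) ⊆ O^×(B_N) ↪ O^×(B_N^birat)` (second coordinate): the kernel clause of `KxRootNModCyclotome` FAILS
  (`not_kxRootNModCyclotome_toyBig`), hence `not_forall_kxRootNModCyclotome`.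

WHAT THIS MEANS FOR THE ROWS (R5).  Both rows are HYPOTHESES ON THE NAMED §5 DATA (the tempered Frobenioid of
[EtTh] Example 3.9 with its Kummer theory over the `p`-adic field `K`), never theorems of the data-only
interface: print's proof of Lemma 5.8 uses "this last set is easily seen to coincide with `(O_K^×)^{1/N}`"
(Kummer theory over `K`, `Ÿ` geometrically connected over `K`) and the surjectivity of the `N`-th power map on
`K̄^×` — arithmetic of the MODEL.  The instance form that stands is L2-t4's PROVED reduction
`ThetaFrobenioid.constantsEqNormalizer_of` (⇐ `SgpCapSection` + `ConstantsActByCyclotome`).  HONEST FRAMING: a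
toy datum says nothing about the tempered Frobenioid of [EtTh] §5, nothing about Lemma 5.8 for it, and nothing
about [IUTchIII] Cor. 3.12; refuted-as-schema ≠ refuted-in-print; no side is taken; typed ≠ proved.
-/

namespace Literature.AnabelianGeometry.EtaleTheta

namespace ThetaFrobenioid

namespace Lem58Toy

open CategoryTheory
open ConstantMultiple.Cor512Toy

/-! ### The two toy data -/

/-- **Toy datum 1**: f-112's toy §5 datum with `N := 3` instead of `2` (no other field depends on `N`).
[cite: MochizukiEtTh2009, Lem 5.8 p.331 (PDF p.105)] -/
def toyThetaN3 : ThetaFrobenioid.{0} TC TD :=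
  { toyTheta with N := 3 }

/-- **Toy datum 2**: f-112's toy §5 datum with `O^×(S^birat) := ℤ/2 × ℤ/2`, the units `O^×(S) (≅ ℤ/2)` embedded
in the FIRST factor, the constants `K^× = 𝔽₂^× = 1 ↪ O^×(B_N^birat)` trivial, `Θ̈ := 1`.
[cite: MochizukiEtTh2009, Lem 5.8 p.331 (PDF p.105)] -/
def toyThetaBig : ThetaFrobenioid.{0} TC TD :=
  { toyTheta with
    biratUnits := fun _ => Mm × Mm
    instCommGroupBirat := fun _ => inferInstance
    unitsToBirat := fun S => (MonoidHom.inl Mm Mm).comp (toyTheta.unitsToBirat S)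
    unitsToBirat_injective := fun S _ _ h =>
      toyTheta.unitsToBirat_injective S (congrArg Prod.fst h)
    constEmb := 1
    constEmb_injective := fun _ _ _ => toyTheta.constEmb_injective rfl
    thetaFn := (1 : Mm × Mm) }

/-! ### Bookkeeping: the unit of order two, commutativity of `Aut_C(Q)` -/

/-- `unitQ ∈ O^×(B_N)` for toy datum 1 (base-identity and linear).
[cite: MochizukiEtTh2009, Lem 5.8 p.331 (PDF p.105)] -/
theorem unitQ_mem_units_N3 : unitQ ∈ toyThetaN3.units toyThetaN3.BN :=
  ⟨rfl, degFr_QQ unitQ.hom⟩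

/-- In toy datum 1 every automorphism of `B_N = Q` normalizes `E_N` (`Aut_C(Q)` is abelian).
[cite: MochizukiEtTh2009, Lem 5.8 p.331 (PDF p.105)] -/
theorem mem_normalizer_EN_N3 (g : Aut toyThetaN3.BN) :
    g ∈ Subgroup.normalizer (toyThetaN3.EN : Set (Aut toyThetaN3.BN)) := by
  rw [Subgroup.mem_normalizer_iff]
  intro h
  rw [show g * h = h * g from aut_mul_comm Q g h, mul_assoc, mul_inv_cancel, mul_one]

/-- In toy datum 1, `(O_K^×)^{1/N} = 1`: an element of `O^×(Q^birat) = ℤ/2` whose cube is a constant (`= 1`) is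
trivial, and `O^×(Q) ↪ O^×(Q^birat)`. [cite: MochizukiEtTh2009, Lem 5.8 p.331 (PDF p.105)] -/
theorem unitQ_not_mem_OKxRootN_N3 : unitQ ∉ toyThetaN3.OKxRootN := by
  intro hu
  obtain ⟨u, hu', hu_eq⟩ := Subgroup.mem_map.mp hu
  rw [Subgroup.mem_comap, ThetaFrobenioid.mem_KxRootN] at hu'
  obtain ⟨k, hk⟩ := hu'
  -- `hk : (constant k) = (u read in O^×(Q^birat)) ^ 3`; the constants are trivial and `u = unitQ` reads `m₀`
  have hk' : (1 : Mm) = autToM Q u.1 ^ 3 := hk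
  have h2 : u.1 = unitQ := hu_eq
  rw [h2] at hk'
  exact absurd hk' (by decide)

/-! ### F-0536: `ConstantsEqNormalizer` -/

/-- Lemma 5.8's identity FAILS at toy datum 1: `unitQ ∈ O^×(B_N) ∩ N(E_N)` but `unitQ ∉ (O_K^×)^{1/N} = 1`.
[cite: MochizukiEtTh2009, Lem 5.8 p.331 (PDF p.105)] -/
theorem not_constantsEqNormalizer_toyN3 : ¬ toyThetaN3.ConstantsEqNormalizer := by
  intro h
  have hmem : unitQ ∈ toyThetaN3.units toyThetaN3.BN ⊓
      Subgroup.normalizer (toyThetaN3.EN : Set (Aut toyThetaN3.BN)) :=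
    Subgroup.mem_inf.mpr ⟨unitQ_mem_units_N3, mem_normalizer_EN_N3 unitQ⟩
  have h' : unitQ ∈ toyThetaN3.OKxRootN := by
    have e : toyThetaN3.OKxRootN = _ := h
    rw [e]
    exact hmem
  exact unitQ_not_mem_OKxRootN_N3 h'

/-- **F-0536: the universal closure of `ThetaFrobenioid.ConstantsEqNormalizer` is FALSE** (R5: the row is an
assumption about the NAMED §5 data; it holds ⇐ `SgpCapSection` + `ConstantsActByCyclotome` by L2-t4's
`constantsEqNormalizer_of`). [cite: MochizukiEtTh2009, Lem 5.8 p.331 (PDF p.105)] -/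
theorem not_forall_constantsEqNormalizer :
    ¬ ∀ (C : Type) [Category.{0} C] (D : Type) [Category.{0} D] (𝔉 : ThetaFrobenioid.{0} C D),
        𝔉.ConstantsEqNormalizer :=
  fun h => not_constantsEqNormalizer_toyN3 (h TC TD toyThetaN3)

/-! ### F-0538: `KxRootNModCyclotome` -/

/-- The kernel clause of Lemma 5.8's "`(K^×)^{1/N}/μ_N(B_N) ⥲ K^×`" FAILS at toy datum 2: `f = (1, m₀)` has
`f ^ N = 1` (so `f ∈ (K^×)^{1/N}`) but is not in the image of `μ_N(B_N)` (whose image lies in the first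
factor). [cite: MochizukiEtTh2009, Lem 5.8 p.331 (PDF p.105)] -/
theorem not_kxRootNModCyclotome_toyBig : ¬ toyThetaBig.KxRootNModCyclotome := by
  rintro ⟨-, h⟩
  -- the element `f = (1, m₀)` of `O^×(B_N^birat) = ℤ/2 × ℤ/2`
  obtain ⟨f, hfdef⟩ : ∃ f : toyThetaBig.biratUnits toyThetaBig.BN, f = ((1 : Mm), m0) := ⟨_, rfl⟩
  have hfN : f ^ (toyThetaBig.N : ℕ) = 1 := by
    subst hfdef
    change (((1 : Mm), m0) : Mm × Mm) ^ 2 = 1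
    decide
  have hf : f ∈ toyThetaBig.KxRootN := by
    rw [ThetaFrobenioid.mem_KxRootN, hfN]
    exact one_mem _
  obtain ⟨x, hx⟩ := MonoidHom.mem_range.mp ((h f hf).mp hfN)
  -- units are embedded in the FIRST factor: the second coordinate of any image is `1`
  have h2 : (((toyThetaBig.unitsToBirat toyThetaBig.BN).comp
      (Subgroup.inclusion (toyThetaBig.muTorsion_le_units toyThetaBig.BN toyThetaBig.N))) x).2 = 1 := rfl
  rw [hx] at h2
  subst hfdef
  exact absurd h2 (by decide)

/-- **F-0538: the universal closure of `ThetaFrobenioid.KxRootNModCyclotome` is FALSE** (R5: the row is an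
assumption about the NAMED §5 data — Kummer theory of the `p`-adic field `K` inside `O^×(B_N^birat)` — never
a theorem of the data-only interface). [cite: MochizukiEtTh2009, Lem 5.8 p.331 (PDF p.105)] -/
theorem not_forall_kxRootNModCyclotome :
    ¬ ∀ (C : Type) [Category.{0} C] (D : Type) [Category.{0} D] (𝔉 : ThetaFrobenioid.{0} C D),
        𝔉.KxRootNModCyclotome :=
  fun h => not_kxRootNModCyclotome_toyBig (h TC TD toyThetaBig)

end Lem58Toy

end ThetaFrobenioid

end Literature.AnabelianGeometry.EtaleTheta
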